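import Literature.NumberTheory.Irrationality.LaiYu2020.ZeroSetCardinality
import Literature.NumberTheory.Multiplicative.SigmaTotientExtremalOrders
import Mathlib.Analysis.SpecialFunctions.Pow.Asymptotics
import HarnessLib

/-!
# Lai–Yu 2020, Lemma 2.4: the arithmetic factors `A₁(B)` and `A₂(B)` — proofs

Topic `Literature/NumberTheory/Irrationality/LaiYu2020`. Third companion ("Proofs") file of
`NumberOfIrrationalOddZetaValues.lean`, for L. Lai, P. Yu, *A note on the number of irrational odd
zeta values*, Compositio Math. **156** (2020) 1699–1717 = arXiv:1911.08458 [LaiYu2020], §2, read on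
the page (arXiv text p. 4):

> «`A₁(B) = ∏_{b ∈ Ψ_B} b^{(2r+1)φ(b)}`, we refer to `A₁(B)ⁿ` the major arithmetic (wasting) factor,
> and `A₂(B) = ∏_{b ∈ Ψ_B} ∏_{p ∣ b} p^{(2r+1)φ(b)/(p−1)}`, we refer to `A₂(B)ⁿ` the minor arithmetic
> (wasting) factor. … **Lemma 2.4.** We have
> `A₁(B) = exp((½ ζ(2)ζ(3)/ζ(6) + o_{B→+∞}(1)) (2r+1) B² log B)`, and for any `B` larger than some
> absolute constant, `A₂(B) ≤ exp(10 (2r+1) B² (log log B)²)`.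
> Proof. We start by `log A₁(B) = (2r+1) ∑_{b ∈ Ψ_B} φ(b) log b`. Firstly,
> `log A₁(B) ≥ (2r+1) ∑_{b ∈ Ψ_B} φ(b) log φ(b) = (2r+1) ∫ x log x d|Ψ_x|`, an integration by parts
> argument with the fact `|Ψ_x| = (ζ(2)ζ(3)/ζ(6) + o(1)) x` … gives
> `log A₁(B) ≥ (2r+1)(½ ζ(2)ζ(3)/ζ(6) + o(1)) B² log B`. On the other hand, it is well known … that
> `φ(m) ≥ (e^{−γ} + o(1)) m / log log m` … For any `b ∈ Ψ_B`, since `φ(b) ≤ B`, we derive that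
> `b ≤ (e^γ + o(1)) B log log B`, thus `log A₁(B) ≤ (2r+1)(1 + o(1)) log B ∑_{b ∈ Ψ_B} φ(b)` … Now,
> for `A₂(B)`, … `log A₂(B) ≤ (2r+1) ∑_{p ≤ 2B log log B} (log p/(p−1)) ∑_{b ≤ 2B log log B, p ∣ b} φ(b)`
> … the estimate for `A₂(B)` follows.»

Since `log A₁(B) = (2r+1) · S₁(B)` and `log A₂(B) = (2r+1) · S₂(B)` with
`S₁(B) = ∑_{b ∈ Ψ_B} φ(b) log b`, `S₂(B) = ∑_{b ∈ Ψ_B} φ(b) ∑_{p ∣ b} log p/(p−1)` (the Ball–Rivoal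
length parameter `r` only enters through the common positive factor `2r+1`), Lemma 2.4 is the pair
of statements PROVED here (theorems only, no definitions, no named facts; sorry-free):

* `tendsto_sum_totient_log_div` — **`S₁(B)/(B² log B) → ½ ζ(2)ζ(3)/ζ(6)`**, i.e.
  `A₁(B) = exp((½ ζ(2)ζ(3)/ζ(6) + o(1))(2r+1) B² log B)` (lower bound: `φ(b) ≤ b` and
  `∑_{Ψ_M} φ log φ ≥ (A/2 − δ) M² log M`, `DenominatorSetProofs.weightedSum_lower`; upper bound:
  `log b ≤ log B/(1−δ)` for `b ∈ Ψ_B` large, from Hardy–Wright Thm 327 `φ(b) ≥ b^{1−δ}`, and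
  `∑_{Ψ_B} φ(b) ≤ (A/2 + η) B²`, `ZeroSetCardinality.sum_totient_bounds`);
* `denominatorSet_le_mul_loglog` — for `B` large every `b ∈ Ψ_B` has `b ≤ 3 B log log B` (Landau's
  `φ(m) ≥ (e^{−γ}+o(1)) m/log log m`, tree `ExtremalOrder.eventually_le_totient_mul_loglog_div`,
  Hardy–Wright Thm 328; the printed constant `2` — from `e^γ = 1.78… < 2` — is replaced by `3`,
  from `e^γ < e^{2/3} < 2`, which is all the next step needs);
* `sum_totient_primeFactors_le` — **`S₂(B) ≤ 10 B² (log log B)²` for all large `B`**, i.e.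
  `A₂(B) ≤ exp(10 (2r+1) B² (log log B)²)` (as printed: `φ(b) ≤ B`, exchange of summations,
  `#{b ≤ N : p ∣ b} = ⌊N/p⌋`, and `∑_n log n/(n(n−1)) < ∞`).

## References

* [LaiYu2020] L. Lai, P. Yu, Compositio Math. 156 (2020) 1699–1717, §2 Def. 2.3 and Lemma 2.4.
* [HardyWright2008] G. H. Hardy, E. M. Wright, *An Introduction to the Theory of Numbers*, 6th ed.,
  Thms 327–328 (tree `SigmaTotientOrder`, `SigmaTotientExtremalOrders`).
-/

noncomputable section

open Filter Topology Finset Asymptotics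
open Literature.NumberTheory.Multiplicative.TotientValueCounting
open Literature.NumberTheory.Multiplicative

namespace Literature.NumberTheory.Irrationality.LaiYu2020

open Literature.NumberTheory.Transcendental (zetaValue)

/-! ### `log A₁(B) = (2r+1) ∑_{b ∈ Ψ_B} φ(b) log b = (½A + o(1))(2r+1) B² log B` -/

/-- [folklore] -/
private theorem mem_levelSet' {M k : ℕ} :
    k ∈ (finite_count_set ((M : ℕ) : ℝ)).toFinset ↔ 0 < k ∧ Nat.totient k ≤ M := by
  rw [Set.Finite.mem_toFinset, Set.mem_setOf_eq, Nat.cast_le]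

/-- [folklore] -/
private theorem card_levelSet' (M : ℕ) :
    ((finite_count_set ((M : ℕ) : ℝ)).toFinset).card = count M := by
  rw [count, Set.ncard_eq_toFinset_card _ (finite_count_set (M : ℝ))]

/-- [folklore] -/
private theorem toFinset_denominatorSet_eq' (B : ℝ) (hB : 0 ≤ B) :
    (denominatorSet_finite B).toFinset = (finite_count_set ((⌊B⌋₊ : ℕ) : ℝ)).toFinset := by
  ext k
  rw [Set.Finite.mem_toFinset, mem_levelSet', mem_denominatorSet, Nat.le_floor_iff hB]

/-- Two-sided estimate of `S₁(N) = ∑_{b ∈ Ψ_N} φ(b) log b` along the integers: for every `ε > 0`,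
eventually `(A/2 − ε) N² log N ≤ S₁(N) ≤ (A/2 + ε) N² log N`.
[cite: LaiYu2020, Lemma 2.4 (proof, `A₁` part)] -/
theorem sum_totient_log_bounds {ε : ℝ} (hε : 0 < ε) :
    ∃ N₀ : ℕ, ∀ N : ℕ, N₀ ≤ N →
      (density / 2 - ε) * (N : ℝ) ^ 2 * Real.log N ≤
          ∑ b ∈ (finite_count_set ((N : ℕ) : ℝ)).toFinset, (Nat.totient b : ℝ) * Real.log b ∧
        ∑ b ∈ (finite_count_set ((N : ℕ) : ℝ)).toFinset, (Nat.totient b : ℝ) * Real.log b ≤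
          (density / 2 + ε) * (N : ℝ) ^ 2 * Real.log N := by
  have hA := density_pos
  -- lower bound via `φ(b) ≤ b` and `weightedSum_lower`
  obtain ⟨M₀, hM₀⟩ := weightedSum_lower hε
  -- upper bound: parameters `δ` (`1/(1-δ) ≤ 1 + η`) and `η`
  set η : ℝ := min (ε / (density + 2)) (1 / 2) with hη
  have hηpos : 0 < η := lt_min (by positivity) (by norm_num)
  have hηle : η ≤ ε / (density + 2) := min_le_left _ _
  have hηhalf : η ≤ 1 / 2 := min_le_right _ _
  set δ : ℝ := η / 2 with hδ
  have hδpos : 0 < δ := by positivity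
  have hδ1 : δ < 1 := by rw [hδ]; linarith
  -- Hardy–Wright 327: eventually `b^{1-δ} ≤ φ(b)`
  obtain ⟨b₀, hb₀⟩ := eventually_atTop.1
    ((SigmaTotientOrder.tendsto_totient_div_rpow_atTop hδpos).eventually_ge_atTop 1)
  obtain ⟨N₁, hN₁⟩ := sum_totient_bounds hηpos
  obtain ⟨X₀, C₀, hX₀, hC₀, -, hup⟩ := count_linear_bounds (η := 1) one_pos
  -- the constant bounding the small `b`
  set K : ℝ := (b₀ : ℝ) * Real.log (b₀ + 1) with hK
  have hKnn : 0 ≤ K := by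
    rw [hK]
    exact mul_nonneg (Nat.cast_nonneg _) (Real.log_nonneg (by
      have : (0:ℝ) ≤ b₀ := Nat.cast_nonneg _; linarith))
  -- choose `N₀`
  obtain ⟨N₂, hN₂⟩ : ∃ N₂ : ℕ, ∀ N : ℕ, N₂ ≤ N →
      K * ((density + 1) * N + C₀) ≤ η * ((N : ℝ) ^ 2 * Real.log N) := by
    -- `K((A+1)N + C₀) / (N² log N) → 0`
    have h1 : Tendsto (fun N : ℕ => (N : ℝ) * Real.log N) atTop atTop :=
      tendsto_natCast_atTop_atTop.atTop_mul_atTop₀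
        (Real.tendsto_log_atTop.comp tendsto_natCast_atTop_atTop)
    have h2 : ∀ᶠ N : ℕ in atTop, K * (density + 1) + K * C₀ ≤ η * ((N : ℝ) * Real.log N) :=
      (h1.const_mul_atTop hηpos).eventually_ge_atTop _
    obtain ⟨N₂, h⟩ := eventually_atTop.1 (h2.and (eventually_ge_atTop 1))
    refine ⟨N₂, fun N hN => ?_⟩
    obtain ⟨h3, hN1⟩ := h N hN
    have hN1' : (1 : ℝ) ≤ N := by exact_mod_cast hN1
    have hlog : 0 ≤ Real.log N := Real.log_nonneg hN1'
    have hNl : 0 ≤ (N : ℝ) * Real.log N := mul_nonneg (by linarith) hlog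
    -- `K((A+1)N + C₀) ≤ (K(A+1) + K C₀) N ≤ η N · (N log N)`
    have e1 : K * ((density + 1) * N + C₀) ≤ (K * (density + 1) + K * C₀) * N := by
      have : K * C₀ ≤ K * C₀ * N := le_mul_of_one_le_right (mul_nonneg hKnn hC₀) hN1'
      nlinarith
    have e2 : (K * (density + 1) + K * C₀) * N ≤ η * ((N : ℝ) * Real.log N) * N :=
      mul_le_mul_of_nonneg_right h3 (by linarith)
    calc K * ((density + 1) * N + C₀) ≤ η * ((N : ℝ) * Real.log N) * N := e1.trans e2
      _ = η * ((N : ℝ) ^ 2 * Real.log N) := by ring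
  refine ⟨max (max M₀ N₁) (max N₂ 2), fun N hN => ?_⟩
  have hNM₀ : M₀ ≤ N := le_trans (le_trans (le_max_left _ _) (le_max_left _ _)) hN
  have hNN₁ : N₁ ≤ N := le_trans (le_trans (le_max_right _ _) (le_max_left _ _)) hN
  have hNN₂ : N₂ ≤ N := le_trans (le_trans (le_max_left _ _) (le_max_right _ _)) hN
  have hN2 : 2 ≤ N := le_trans (le_trans (le_max_right _ _) (le_max_right _ _)) hN
  have hN1 : (1 : ℝ) < N := by exact_mod_cast hN2
  have hlogN : 0 < Real.log N := Real.log_pos hN1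
  constructor
  · -- lower bound
    refine (hM₀ N hNM₀).trans (sum_le_sum fun b hb => ?_)
    rw [mem_levelSet'] at hb
    have hφ : (0 : ℝ) < Nat.totient b := by exact_mod_cast Nat.totient_pos.2 hb.1
    exact mul_le_mul_of_nonneg_left
      (Real.log_le_log hφ (by exact_mod_cast Nat.totient_le b)) (Nat.cast_nonneg _)
  · -- upper bound: termwise `φ(b) log b ≤ φ(b) log N/(1-δ) + K`
    have hterm : ∀ b ∈ (finite_count_set ((N : ℕ) : ℝ)).toFinset,
        (Nat.totient b : ℝ) * Real.log b ≤ (Nat.totient b : ℝ) * (Real.log N / (1 - δ)) + K := by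
      intro b hb
      rw [mem_levelSet'] at hb
      have hb1 : (1 : ℝ) ≤ b := by exact_mod_cast hb.1
      have hφnn : (0 : ℝ) ≤ Nat.totient b := Nat.cast_nonneg _
      by_cases hbb₀ : b₀ ≤ b
      · -- `b^{1-δ} ≤ φ(b) ≤ N`, so `(1-δ) log b ≤ log N`
        have h1 := hb₀ b hbb₀
        have hbpos : (0 : ℝ) < b := by linarith
        have hpow : 0 < (b : ℝ) ^ (1 - δ) := Real.rpow_pos_of_pos hbpos _
        rw [le_div_iff₀ hpow, one_mul] at h1
        have h2 : (b : ℝ) ^ (1 - δ) ≤ N := h1.trans (by exact_mod_cast hb.2)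
        have h3 : (1 - δ) * Real.log b ≤ Real.log N := by
          have := Real.log_le_log hpow h2
          rwa [Real.log_rpow hbpos] at this
        have h4 : Real.log b ≤ Real.log N / (1 - δ) := by
          rw [le_div_iff₀ (by linarith)]; linarith
        have := mul_le_mul_of_nonneg_left h4 hφnn
        linarith
      · -- small `b`: `φ(b) log b ≤ b₀ log (b₀ + 1) = K`
        push Not at hbb₀
        have h1 : (Nat.totient b : ℝ) * Real.log b ≤ K := by
          rw [hK]
          have hlogb : 0 ≤ Real.log b := Real.log_nonneg hb1
          refine mul_le_mul (by exact_mod_cast (Nat.totient_le b).trans hbb₀.le)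
            (Real.log_le_log (by linarith) (by exact_mod_cast (by omega : b ≤ b₀ + 1)))
            hlogb (Nat.cast_nonneg _)
        have h2 : 0 ≤ (Nat.totient b : ℝ) * (Real.log N / (1 - δ)) :=
          mul_nonneg hφnn (div_nonneg hlogN.le (by linarith))
        linarith
    refine (sum_le_sum hterm).trans ?_
    rw [sum_add_distrib, sum_const, nsmul_eq_mul, ← sum_mul, card_levelSet']
    have hS := (hN₁ N hNN₁).2
    have hcount : (count (N : ℕ) : ℝ) ≤ (density + 1) * N + C₀ := hup N
    have hKC := hN₂ N hNN₂
    -- `(A/2 + η) N² · log N/(1-δ) + count(N)·K ≤ (A/2 + ε) N² log N`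
    have hN2sq : (0 : ℝ) ≤ (N : ℝ) ^ 2 * Real.log N := by positivity
    have h1 : (∑ b ∈ (finite_count_set ((N : ℕ) : ℝ)).toFinset, (Nat.totient b : ℝ)) *
        (Real.log N / (1 - δ)) ≤ (density / 2 + η) * (N : ℝ) ^ 2 * (Real.log N / (1 - δ)) := by
      have : (∑ b ∈ (finite_count_set ((N : ℕ) : ℝ)).toFinset, (Nat.totient b : ℝ)) =
          ((∑ b ∈ (finite_count_set ((N : ℕ) : ℝ)).toFinset, Nat.totient b : ℕ) : ℝ) := by
        push_cast; rfl
      rw [this]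
      exact mul_le_mul_of_nonneg_right hS (div_nonneg hlogN.le (by linarith))
    have h2 : (count (N : ℕ) : ℝ) * K ≤ η * ((N : ℝ) ^ 2 * Real.log N) := by
      calc (count (N : ℕ) : ℝ) * K ≤ ((density + 1) * N + C₀) * K :=
            mul_le_mul_of_nonneg_right hcount hKnn
        _ = K * ((density + 1) * N + C₀) := mul_comm _ _
        _ ≤ η * ((N : ℝ) ^ 2 * Real.log N) := hKC
    -- `1/(1-δ) ≤ 1 + η` (as `δ = η/2 ≤ 1/4`)
    have h3 : Real.log N / (1 - δ) ≤ (1 + η) * Real.log N := by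
      rw [div_le_iff₀ (by linarith)]
      have : 1 ≤ (1 + η) * (1 - δ) := by rw [hδ]; nlinarith
      nlinarith
    have h4 : (density / 2 + η) * (N : ℝ) ^ 2 * (Real.log N / (1 - δ)) ≤
        (density / 2 + η) * (N : ℝ) ^ 2 * ((1 + η) * Real.log N) :=
      mul_le_mul_of_nonneg_left h3 (by positivity)
    -- `(A/2 + η)(1 + η) + η ≤ A/2 + ε`
    have h5 : (density / 2 + η) * (1 + η) + η ≤ density / 2 + ε := by
      have hε' : η * (density + 2) ≤ ε := by
        have := hηle; rwa [le_div_iff₀ (by linarith)] at this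
      have hA1 := one_le_density
      have e1 : (density / 2 + η) * (1 + η) + η = density / 2 + η * (density / 2 + 2 + η) := by
        ring
      have e2 : η * (density / 2 + 2 + η) ≤ η * (density + 2) :=
        mul_le_mul_of_nonneg_left (by linarith) hηpos.le
      linarith
    calc (∑ b ∈ (finite_count_set ((N : ℕ) : ℝ)).toFinset, (Nat.totient b : ℝ)) *
          (Real.log N / (1 - δ)) + (count (N : ℕ) : ℝ) * K
        ≤ (density / 2 + η) * (N : ℝ) ^ 2 * ((1 + η) * Real.log N) +
            η * ((N : ℝ) ^ 2 * Real.log N) := add_le_add (h1.trans h4) h2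
      _ = ((density / 2 + η) * (1 + η) + η) * ((N : ℝ) ^ 2 * Real.log N) := by ring
      _ ≤ (density / 2 + ε) * ((N : ℝ) ^ 2 * Real.log N) := mul_le_mul_of_nonneg_right h5 hN2sq
      _ = (density / 2 + ε) * (N : ℝ) ^ 2 * Real.log N := by ring

/-- **Lemma 2.4, `A₁` part, along the integers**: `S₁(N)/(N² log N) → ½ ζ(2)ζ(3)/ζ(6)`.
[cite: LaiYu2020, Lemma 2.4] -/
theorem tendsto_sum_totient_log_div_nat :
    Tendsto (fun N : ℕ => (∑ b ∈ (finite_count_set ((N : ℕ) : ℝ)).toFinset,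
      (Nat.totient b : ℝ) * Real.log b) / ((N : ℝ) ^ 2 * Real.log N)) atTop (𝓝 (density / 2)) := by
  refine tendsto_order.2 ⟨fun a ha => ?_, fun a ha => ?_⟩
  · obtain ⟨N₀, hN₀⟩ := sum_totient_log_bounds (ε := (density / 2 - a) / 2) (by linarith)
    filter_upwards [eventually_ge_atTop (max N₀ 2)] with N hN
    have hN2 : (1 : ℝ) < N := by
      exact_mod_cast lt_of_lt_of_le (by norm_num) (le_trans (le_max_right _ _) hN)
    have hpos : 0 < (N : ℝ) ^ 2 * Real.log N := by have := Real.log_pos hN2; positivity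
    have h := (hN₀ N (le_trans (le_max_left _ _) hN)).1
    rw [lt_div_iff₀ hpos]
    have : 0 < (density / 2 - a) / 2 * ((N : ℝ) ^ 2 * Real.log N) := mul_pos (by linarith) hpos
    linarith
  · obtain ⟨N₀, hN₀⟩ := sum_totient_log_bounds (ε := (a - density / 2) / 2) (by linarith)
    filter_upwards [eventually_ge_atTop (max N₀ 2)] with N hN
    have hN2 : (1 : ℝ) < N := by
      exact_mod_cast lt_of_lt_of_le (by norm_num) (le_trans (le_max_right _ _) hN)
    have hpos : 0 < (N : ℝ) ^ 2 * Real.log N := by have := Real.log_pos hN2; positivity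
    have h := (hN₀ N (le_trans (le_max_left _ _) hN)).2
    rw [div_lt_iff₀ hpos]
    have : 0 < (a - density / 2) / 2 * ((N : ℝ) ^ 2 * Real.log N) := mul_pos (by linarith) hpos
    linarith

/-- **Lai–Yu 2020, Lemma 2.4, `A₁` part** (PROVED):
`∑_{b ∈ Ψ_B} φ(b) log b = (½ ζ(2)ζ(3)/ζ(6) + o(1)) B² log B` (`B → +∞`), i.e.
`A₁(B) = exp((½ ζ(2)ζ(3)/ζ(6) + o(1)) (2r+1) B² log B)`. [cite: LaiYu2020, Lemma 2.4] -/
theorem tendsto_sum_totient_log_div :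
    Tendsto (fun B : ℝ => (∑ b ∈ (denominatorSet_finite B).toFinset,
      (Nat.totient b : ℝ) * Real.log b) / (B ^ 2 * Real.log B)) atTop (𝓝 (density / 2)) := by
  have h1 := tendsto_sum_totient_log_div_nat.comp (tendsto_nat_floor_atTop (α := ℝ))
  -- `(⌊B⌋² log ⌊B⌋)/(B² log B) → 1`
  have hfl : Tendsto (fun B : ℝ => (⌊B⌋₊ : ℝ) / B) atTop (𝓝 1) := tendsto_nat_floor_div_atTop
  have hlog : Tendsto (fun B : ℝ => Real.log ((⌊B⌋₊ : ℝ) / B)) atTop (𝓝 0) := by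
    have := ((Real.continuousAt_log one_ne_zero).tendsto).comp hfl
    rwa [Real.log_one] at this
  have hinv : Tendsto (fun B : ℝ => (Real.log B)⁻¹) atTop (𝓝 0) :=
    Real.tendsto_log_atTop.inv_tendsto_atTop
  have h3 : Tendsto (fun B : ℝ => 1 + Real.log ((⌊B⌋₊ : ℝ) / B) * (Real.log B)⁻¹) atTop (𝓝 1) := by
    have := (hlog.mul hinv).const_add 1
    rwa [mul_zero, add_zero] at this
  have h2 : Tendsto (fun B : ℝ => ((⌊B⌋₊ : ℝ) ^ 2 * Real.log (⌊B⌋₊ : ℝ)) / (B ^ 2 * Real.log B))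
      atTop (𝓝 1) := by
    have h4 := (hfl.pow 2).mul h3
    rw [one_pow, one_mul] at h4
    refine h4.congr' ?_
    filter_upwards [eventually_gt_atTop 1] with B hB
    have hB0 : 0 < B := by linarith
    have hfl0 : (0 : ℝ) < ⌊B⌋₊ := by exact_mod_cast Nat.floor_pos.2 hB.le
    have hlogB : Real.log B ≠ 0 := (Real.log_pos hB).ne'
    rw [Real.log_div hfl0.ne' hB0.ne']
    field_simp
    ring
  have h := h1.mul h2
  rw [mul_one] at h
  refine h.congr' ?_
  filter_upwards [eventually_ge_atTop 2] with B hB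
  have hB0 : 0 ≤ B := by linarith
  have hfl2 : (2 : ℝ) ≤ ⌊B⌋₊ := by exact_mod_cast Nat.le_floor hB
  have hlogfl : 0 < Real.log (⌊B⌋₊ : ℝ) := Real.log_pos (by linarith)
  have hpos : (⌊B⌋₊ : ℝ) ^ 2 * Real.log (⌊B⌋₊ : ℝ) ≠ 0 := by positivity
  simp only [Function.comp_apply]
  rw [toFinset_denominatorSet_eq' B hB0, div_mul_div_comm, mul_comm _ ((⌊B⌋₊ : ℝ) ^ 2 * _),
    mul_div_mul_left _ _ hpos]

/-! ### `b ≤ 3 B log log B` on `Ψ_B` (Landau) -/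

/-- `½ < e^{−γ}` (`γ < 2/3 < log 2`). [folklore] -/
private theorem half_lt_exp_neg_gamma : (1 / 2 : ℝ) < Real.exp (-Real.eulerMascheroniConstant) := by
  have h1 : Real.eulerMascheroniConstant < Real.log 2 :=
    Real.eulerMascheroniConstant_lt_two_thirds.trans (by have := Real.log_two_gt_d9; linarith)
  have h2 : Real.exp (-Real.log 2) < Real.exp (-Real.eulerMascheroniConstant) :=
    Real.exp_lt_exp.2 (by linarith)
  rw [Real.exp_neg, Real.exp_log two_pos] at h2
  linarith

/-- For all large `B`, every `b ∈ Ψ_B` satisfies **`b ≤ 3 B log log B`** (Lai–Yu: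
`b ≤ (e^γ + o(1)) B log log B`, from Landau's `φ(m) ≥ (e^{−γ} + o(1)) m / log log m`,
Hardy–Wright Thm 328; here with `e^{−γ} > ½`). [cite: LaiYu2020, Lemma 2.4 (proof)] -/
theorem denominatorSet_le_mul_loglog :
    ∃ B₀ : ℝ, ∀ B : ℝ, B₀ ≤ B → ∀ b ∈ denominatorSet B,
      (b : ℝ) ≤ 3 * B * Real.log (Real.log B) := by
  -- Landau with `c = 1/2`: eventually `b/2 ≤ φ(b) log log b`
  obtain ⟨b₁, hb₁⟩ := eventually_atTop.1
    (ExtremalOrder.eventually_le_totient_mul_loglog_div half_lt_exp_neg_gamma)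
  -- eventually `log log b ≤ √b / 2`
  obtain ⟨b₂, hb₂⟩ : ∃ b₂ : ℕ, ∀ b : ℕ, b₂ ≤ b → Real.log (Real.log b) ≤ Real.sqrt b / 2 := by
    have h := (isLittleO_log_rpow_atTop (by norm_num : (0 : ℝ) < 1 / 2)).bound
      (by norm_num : (0 : ℝ) < 1 / 2)
    obtain ⟨b₂, hb⟩ := eventually_atTop.1
      (tendsto_natCast_atTop_atTop.eventually (h.and (eventually_ge_atTop (1 : ℝ))))
    refine ⟨b₂, fun b hb' => ?_⟩
    obtain ⟨h1, h2⟩ := hb b hb'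
    have hlogb : 0 ≤ Real.log b := Real.log_nonneg h2
    have hll : Real.log (Real.log b) ≤ Real.log b := by
      rcases hlogb.eq_or_lt with h0 | hpos
      · rw [← h0, Real.log_zero]
      · linarith [Real.log_le_sub_one_of_pos hpos]
    rw [Real.norm_of_nonneg hlogb, Real.norm_of_nonneg (Real.rpow_nonneg (by linarith) _),
      ← Real.sqrt_eq_rpow] at h1
    linarith
  set b₃ : ℕ := max (max b₁ b₂) 16 with hb₃
  refine ⟨max (b₃ : ℝ) (Real.exp (Real.exp 2)), fun B hB b hb => ?_⟩
  have hBb₃ : (b₃ : ℝ) ≤ B := le_trans (le_max_left _ _) hB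
  have hBexp : Real.exp (Real.exp 2) ≤ B := le_trans (le_max_right _ _) hB
  have hB1 : 1 < B := lt_of_lt_of_le (by
    have := Real.add_one_le_exp (Real.exp 2); have := Real.exp_pos 2; linarith) hBexp
  have hB0 : 0 < B := by linarith
  have hL : 2 ≤ Real.log (Real.log B) := by
    rw [Real.le_log_iff_exp_le (Real.log_pos hB1), Real.le_log_iff_exp_le hB0]
    exact hBexp
  obtain ⟨hb0, hφB⟩ := (mem_denominatorSet).1 hb
  by_cases hsmall : b < b₃
  · have h1 : (b : ℝ) ≤ B := le_trans (by exact_mod_cast hsmall.le) hBb₃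
    have h2 : B ≤ 3 * B * Real.log (Real.log B) := by nlinarith
    exact h1.trans h2
  · push Not at hsmall
    have hbb₁ : b₁ ≤ b := le_trans (le_trans (le_max_left _ _) (le_max_left _ _)) hsmall
    have hbb₂ : b₂ ≤ b := le_trans (le_trans (le_max_right _ _) (le_max_left _ _)) hsmall
    have hb16 : 16 ≤ b := le_trans (le_max_right _ _) hsmall
    have hbpos : (0 : ℝ) < b := by exact_mod_cast hb0
    have key := hb₁ b hbb₁
    rw [le_div_iff₀ hbpos] at key
    -- `0 < log log b` (`b ≥ 16 > e`)
    have hlogb : 1 < Real.log b := by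
      rw [Real.lt_log_iff_exp_lt hbpos]
      have h16 : (16 : ℝ) ≤ b := by exact_mod_cast hb16
      exact lt_of_lt_of_le (Real.exp_one_lt_d9.trans (by norm_num)) h16
    have hllpos : 0 < Real.log (Real.log b) := Real.log_pos hlogb
    -- (i) `b ≤ B²`
    have hbB2 : (b : ℝ) ≤ B ^ 2 := by
      by_contra hcon
      push Not at hcon
      have hBlt : B < Real.sqrt b := by
        calc B = Real.sqrt (B ^ 2) := (Real.sqrt_sq hB0.le).symm
          _ < Real.sqrt b := Real.sqrt_lt_sqrt (sq_nonneg _) hcon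
      have h2 := hb₂ b hbb₂
      have h3 : (Nat.totient b : ℝ) * Real.log (Real.log b) ≤ B * Real.log (Real.log b) :=
        mul_le_mul_of_nonneg_right hφB hllpos.le
      have h4 : B * Real.log (Real.log b) < Real.sqrt b * Real.log (Real.log b) :=
        mul_lt_mul_of_pos_right hBlt hllpos
      have h5 : Real.sqrt b * Real.log (Real.log b) ≤ Real.sqrt b * (Real.sqrt b / 2) :=
        mul_le_mul_of_nonneg_left h2 (Real.sqrt_nonneg _)
      have h6 : Real.sqrt (b : ℝ) * Real.sqrt b = b := Real.mul_self_sqrt hbpos.le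
      nlinarith
    -- (ii) `log log b ≤ log 2 + log log B`
    have hll : Real.log (Real.log b) ≤ Real.log 2 + Real.log (Real.log B) := by
      have h1 : Real.log b ≤ 2 * Real.log B := by
        have := Real.log_le_log hbpos hbB2
        rwa [Real.log_pow, Nat.cast_ofNat] at this
      have h2 := Real.log_le_log (by linarith) h1
      rwa [Real.log_mul two_ne_zero (Real.log_pos hB1).ne'] at h2
    -- (iii) `b ≤ 2 B (log 2 + log log B) ≤ 3 B log log B`
    have hlog2 := Real.log_two_lt_d9
    have h1 : (b : ℝ) ≤ 2 * B * (Real.log 2 + Real.log (Real.log B)) := by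
      have := mul_le_mul hφB hll hllpos.le hB0.le
      linarith
    have h2 : 2 * B * (Real.log 2 + Real.log (Real.log B)) ≤ 3 * B * Real.log (Real.log B) := by
      nlinarith
    exact h1.trans h2

/-! ### `log A₂(B) = (2r+1) ∑_{b ∈ Ψ_B} φ(b) ∑_{p ∣ b} log p/(p−1) ≤ 10 (2r+1) B² (log log B)²` -/

/-- `∑_{2 ≤ n ≤ N} log n/(n(n−1)) ≤ ∑_n 4 n^{−3/2}` (`log n ≤ 2√n`, `n(n−1) ≥ n²/2`). [folklore] -/
private theorem sum_log_div_le (N : ℕ) :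
    ∑ n ∈ Icc 2 N, Real.log n / ((n : ℝ) * ((n : ℝ) - 1)) ≤
      ∑' n : ℕ, 4 * (n : ℝ) ^ (-(3 / 2 : ℝ)) := by
  have hs : Summable (fun n : ℕ => 4 * (n : ℝ) ^ (-(3 / 2 : ℝ))) :=
    (Real.summable_nat_rpow.2 (by norm_num)).mul_left 4
  refine le_trans (sum_le_sum fun n hn => ?_)
    (hs.sum_le_tsum (Icc 2 N) (fun n _ => by positivity))
  rw [mem_Icc] at hn
  have hn2 : (2 : ℝ) ≤ n := by exact_mod_cast hn.1
  have hnpos : (0 : ℝ) < n := by linarith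
  have hlog : Real.log n ≤ 2 * Real.sqrt n := by
    have h := Real.log_le_sub_one_of_pos (Real.sqrt_pos.2 hnpos)
    rw [Real.log_sqrt hnpos.le] at h
    linarith [Real.sqrt_nonneg (n : ℝ)]
  have hsq : Real.sqrt (n : ℝ) = (n : ℝ) ^ (1 / 2 : ℝ) := Real.sqrt_eq_rpow n
  have e : (n : ℝ) ^ (-(3 / 2 : ℝ)) * ((n : ℝ) * n) = (n : ℝ) ^ (1 / 2 : ℝ) := by
    rw [show (n : ℝ) * n = (n : ℝ) ^ (2 : ℝ) by rw [Real.rpow_two, sq], ← Real.rpow_add hnpos]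
    norm_num
  have h1 : (n : ℝ) * n / 2 ≤ (n : ℝ) * ((n : ℝ) - 1) := by nlinarith
  rw [div_le_iff₀ (by nlinarith)]
  calc Real.log n ≤ 2 * (n : ℝ) ^ (1 / 2 : ℝ) := by rw [← hsq]; exact hlog
    _ = 4 * (n : ℝ) ^ (-(3 / 2 : ℝ)) * ((n : ℝ) * n / 2) := by rw [← e]; ring
    _ ≤ 4 * (n : ℝ) ^ (-(3 / 2 : ℝ)) * ((n : ℝ) * ((n : ℝ) - 1)) :=
        mul_le_mul_of_nonneg_left h1 (by positivity)

/-- Exchange of summations: `∑_{b=1}^{N} ∑_{p ∣ b} f(p) = ∑_{p ≤ N prime} f(p) ⌊N/p⌋`. [folklore] -/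
private theorem sum_primeFactors_eq (N : ℕ) (f : ℕ → ℝ) :
    ∑ b ∈ Icc 1 N, ∑ p ∈ b.primeFactors, f p =
      ∑ p ∈ (Icc 1 N).filter Nat.Prime, f p * ((N / p : ℕ) : ℝ) := by
  classical
  have h1 : ∀ b ∈ Icc 1 N, ∑ p ∈ b.primeFactors, f p =
      ∑ p ∈ (Icc 1 N).filter Nat.Prime, if p ∣ b then f p else 0 := by
    intro b hb
    rw [mem_Icc] at hb
    rw [← Finset.sum_filter]
    refine sum_congr ?_ fun _ _ => rfl
    ext p
    simp only [Nat.mem_primeFactors, mem_filter, mem_Icc]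
    constructor
    · rintro ⟨hp, hpb, -⟩
      exact ⟨⟨⟨hp.one_lt.le, (Nat.le_of_dvd (by omega) hpb).trans hb.2⟩, hp⟩, hpb⟩
    · rintro ⟨⟨-, hp⟩, hpb⟩
      exact ⟨hp, hpb, by omega⟩
  rw [sum_congr rfl h1, sum_comm]
  refine sum_congr rfl fun p _ => ?_
  rw [← Finset.sum_filter, sum_const, nsmul_eq_mul, mul_comm]
  congr 2
  have hI : Finset.Icc 1 N = Finset.Ioc 0 N := by
    ext x
    simp only [mem_Icc, mem_Ioc]
    omega
  rw [hI]
  exact_mod_cast Nat.Ioc_filter_dvd_card_eq_div N p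

/-- **Lai–Yu 2020, Lemma 2.4, `A₂` part** (PROVED): for every `B` larger than some absolute
constant, `∑_{b ∈ Ψ_B} φ(b) ∑_{p ∣ b} log p/(p−1) ≤ 10 B² (log log B)²`, i.e.
`A₂(B) ≤ exp(10 (2r+1) B² (log log B)²)`. [cite: LaiYu2020, Lemma 2.4] -/
theorem sum_totient_primeFactors_le :
    ∃ B₀ : ℝ, ∀ B : ℝ, B₀ ≤ B →
      ∑ b ∈ (denominatorSet_finite B).toFinset,
          (Nat.totient b : ℝ) * ∑ p ∈ b.primeFactors, Real.log p / ((p : ℝ) - 1) ≤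
        10 * B ^ 2 * Real.log (Real.log B) ^ 2 := by
  set K₀ : ℝ := ∑' n : ℕ, 4 * (n : ℝ) ^ (-(3 / 2 : ℝ)) with hK₀def
  have hK₀ : 0 ≤ K₀ := tsum_nonneg fun n => by positivity
  obtain ⟨B₁, hB₁⟩ := denominatorSet_le_mul_loglog
  refine ⟨max B₁ (Real.exp (Real.exp (3 * K₀ / 10 + 1))), fun B hB => ?_⟩
  have hBB₁ : B₁ ≤ B := le_trans (le_max_left _ _) hB
  have hBexp : Real.exp (Real.exp (3 * K₀ / 10 + 1)) ≤ B := le_trans (le_max_right _ _) hB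
  have hB1 : 1 < B := lt_of_lt_of_le (by
    have := Real.add_one_le_exp (Real.exp (3 * K₀ / 10 + 1))
    have := Real.exp_pos (3 * K₀ / 10 + 1); linarith) hBexp
  have hB0 : 0 < B := by linarith
  have hL : 3 * K₀ / 10 + 1 ≤ Real.log (Real.log B) := by
    rw [Real.le_log_iff_exp_le (Real.log_pos hB1), Real.le_log_iff_exp_le hB0]
    exact hBexp
  have hL0 : 0 < Real.log (Real.log B) := by linarith
  set Y : ℝ := 3 * B * Real.log (Real.log B) with hY
  have hY0 : 0 ≤ Y := by positivity
  set N : ℕ := ⌊Y⌋₊ with hN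
  -- the weights are nonnegative
  have hw_nn : ∀ b : ℕ, 0 ≤ ∑ p ∈ b.primeFactors, Real.log p / ((p : ℝ) - 1) := by
    intro b
    refine sum_nonneg fun p hp => ?_
    have hp2 : (2 : ℝ) ≤ p := by exact_mod_cast (Nat.prime_of_mem_primeFactors hp).two_le
    exact div_nonneg (Real.log_nonneg (by linarith)) (by linarith)
  -- `Ψ_B ⊆ [1, N]`
  have hsub : (denominatorSet_finite B).toFinset ⊆ Icc 1 N := by
    intro b hb
    rw [Set.Finite.mem_toFinset] at hb
    have h := hB₁ B hBB₁ b hb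
    rw [mem_Icc]
    exact ⟨hb.1, Nat.le_floor h⟩
  -- Step 1: `S₂ ≤ B ∑_{b ≤ N} w(b)`
  have hS1 : ∑ b ∈ (denominatorSet_finite B).toFinset,
      (Nat.totient b : ℝ) * ∑ p ∈ b.primeFactors, Real.log p / ((p : ℝ) - 1) ≤
        B * ∑ b ∈ Icc 1 N, ∑ p ∈ b.primeFactors, Real.log p / ((p : ℝ) - 1) := by
    calc ∑ b ∈ (denominatorSet_finite B).toFinset,
          (Nat.totient b : ℝ) * ∑ p ∈ b.primeFactors, Real.log p / ((p : ℝ) - 1)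
        ≤ ∑ b ∈ (denominatorSet_finite B).toFinset,
            B * ∑ p ∈ b.primeFactors, Real.log p / ((p : ℝ) - 1) := by
          refine sum_le_sum fun b hb => ?_
          rw [Set.Finite.mem_toFinset] at hb
          exact mul_le_mul_of_nonneg_right hb.2 (hw_nn b)
      _ = B * ∑ b ∈ (denominatorSet_finite B).toFinset,
            ∑ p ∈ b.primeFactors, Real.log p / ((p : ℝ) - 1) := by rw [mul_sum]
      _ ≤ B * ∑ b ∈ Icc 1 N, ∑ p ∈ b.primeFactors, Real.log p / ((p : ℝ) - 1) :=
          mul_le_mul_of_nonneg_left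
            (sum_le_sum_of_subset_of_nonneg hsub fun b _ _ => hw_nn b) hB0.le
  -- Step 2: `∑_{b ≤ N} w(b) = ∑_p (log p/(p-1)) ⌊N/p⌋ ≤ N K₀`
  have hS2 : ∑ b ∈ Icc 1 N, ∑ p ∈ b.primeFactors, Real.log p / ((p : ℝ) - 1) ≤ N * K₀ := by
    rw [sum_primeFactors_eq N (fun p => Real.log p / ((p : ℝ) - 1))]
    have hP : ∀ p ∈ (Icc 1 N).filter Nat.Prime, (2 : ℝ) ≤ p ∧ p ≤ N := by
      intro p hp
      simp only [mem_filter, mem_Icc] at hp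
      exact ⟨by exact_mod_cast hp.2.two_le, hp.1.2⟩
    calc ∑ p ∈ (Icc 1 N).filter Nat.Prime, Real.log p / ((p : ℝ) - 1) * ((N / p : ℕ) : ℝ)
        ≤ ∑ p ∈ (Icc 1 N).filter Nat.Prime, Real.log p / ((p : ℝ) - 1) * ((N : ℝ) / p) := by
          refine sum_le_sum fun p hp => ?_
          obtain ⟨hp2, -⟩ := hP p hp
          exact mul_le_mul_of_nonneg_left Nat.cast_div_le
            (div_nonneg (Real.log_nonneg (by linarith)) (by linarith))
      _ = (N : ℝ) * ∑ p ∈ (Icc 1 N).filter Nat.Prime, Real.log p / ((p : ℝ) * ((p : ℝ) - 1)) := by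
          rw [mul_sum]
          refine sum_congr rfl fun p hp => ?_
          obtain ⟨hp2, -⟩ := hP p hp
          have : (p : ℝ) ≠ 0 := by positivity
          have : (p : ℝ) - 1 ≠ 0 := by linarith
          field_simp
      _ ≤ (N : ℝ) * ∑ n ∈ Icc 2 N, Real.log n / ((n : ℝ) * ((n : ℝ) - 1)) := by
          refine mul_le_mul_of_nonneg_left (sum_le_sum_of_subset_of_nonneg ?_ ?_) (Nat.cast_nonneg _)
          · intro p hp
            have h := hP p hp
            simp only [mem_filter, mem_Icc] at hp ⊢
            exact ⟨hp.2.two_le, hp.1.2⟩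
          · intro n hn _
            rw [mem_Icc] at hn
            have hn2 : (2 : ℝ) ≤ n := by exact_mod_cast hn.1
            exact div_nonneg (Real.log_nonneg (by linarith)) (by nlinarith)
      _ ≤ (N : ℝ) * K₀ := mul_le_mul_of_nonneg_left (sum_log_div_le N) (Nat.cast_nonneg _)
  -- Step 3: combine
  have hNY : (N : ℝ) ≤ Y := Nat.floor_le hY0
  calc ∑ b ∈ (denominatorSet_finite B).toFinset,
        (Nat.totient b : ℝ) * ∑ p ∈ b.primeFactors, Real.log p / ((p : ℝ) - 1)
      ≤ B * ((N : ℝ) * K₀) := hS1.trans (mul_le_mul_of_nonneg_left hS2 hB0.le)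
    _ ≤ B * (Y * K₀) := mul_le_mul_of_nonneg_left (mul_le_mul_of_nonneg_right hNY hK₀) hB0.le
    _ = 3 * K₀ * (B ^ 2 * Real.log (Real.log B)) := by rw [hY]; ring
    _ ≤ 10 * Real.log (Real.log B) * (B ^ 2 * Real.log (Real.log B)) :=
        mul_le_mul_of_nonneg_right (by linarith) (by positivity)
    _ = 10 * B ^ 2 * Real.log (Real.log B) ^ 2 := by ring

end Literature.NumberTheory.Irrationality.LaiYu2020

end
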